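import Mathlib.Analysis.Calculus.Deriv.Add
import Mathlib.Analysis.Calculus.Deriv.Mul
import Literature.Probability.Percolation.ProdBernoulliRusso
import Literature.Probability.LatticeModels.ProdBernoulliIndependence

/-!
# Stub `stub_cone3` of line `finite-size-envelope` (crux `CriticalPathRSW`), part 1:
signed Russo formula and cylinder bookkeeping for `prodBernoulli`

Support file for item `stmt-CriticalPhenomena-10267` (route `CardySelfRefinement`, crux
`CriticalPathRSW`, line finite-size-envelope, stub `stub_cone3`: the pointwise one-sided Russo
cone for the self-refinement measure `M_3(ρ, c)`).  This part is model-free: for the product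
Bernoulli measure `prodBernoulli p` on `Set ι` it provides

* `Cone3.hasDerivAt_prodBernoulli_real_signed` — **Russo's formula along a differentiable path of
  parameters for an ARBITRARY (not necessarily increasing) event** `A` determined by a finite set
  `K`: `d/db P_{p(b)}(A) = Σ_{e ∈ K} p_e'(b) · (P(A^{e←1}) - P(A^{e←0}))`, where
  `A^{e←1} = {ω | ω ∪ {e} ∈ A}` and `A^{e←0} = {ω | ω \ {e} ∈ A}` are the two sections of `A` at
  `e` (for increasing `A` the bracket is `P(e pivotal)`, the tree's `hasDerivAt_prodBernoulli_real`);
* `Cone3.determinedBy_preimage_diff_union` — the section `{ω | (ω \ D) ∪ I ∈ A}` of an event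
  determined by `K` is determined by `K \ (D ∪ I)`, and the modification map is measurable;
* `Cone3.measureReal_eq_sum_inter_localCylinder` — `P(E) = Σ_{T ⊆ F} P(E ∩ [T]_F)` (the cylinders
  over a finite `F` partition the space) and `Cone3.real_localCylinder_inter` —
  `P([T]_F ∩ E) = P([T]_F) · P(E)` for `E` determined by `Fᶜ`.

References: L. Russo, Z. Wahrsch. 56 (1981) §4 Lemma 3; G. Grimmett, *Percolation* (1999) §2.4,
Thm. 2.25 and (for non-monotone events) §2.4 eq. (2.28); M. Aizenman, G. Grimmett, J. Stat. Phys. 63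
(1991) §2 (signed Russo bookkeeping for essential enhancements).
-/

noncomputable section

namespace Summit.CriticalPhenomena.CardyFormulaZ2.Cruxes.CriticalPathRSW.FiniteSizeEnvelope

open Set MeasureTheory Filter Topology
open Literature.Probability.LatticeModels Literature.Probability.Percolation

namespace Cone3

variable {ι : Type*}

/-! ### Sections of determined events -/

/-- The section `{ω | (ω \ D) ∪ I ∈ A}` of an event `A` determined by `K` is determined by
`K \ (D ∪ I)`: the modified configuration does not read the coordinates in `D ∪ I`. -/
theorem determinedBy_preimage_diff_union {A : Set (Set ι)} {K : Set ι} (hA : DeterminedBy A K)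
    (D I : Set ι) :
    DeterminedBy ((fun ω : Set ι => ω \ D ∪ I) ⁻¹' A) (K \ (D ∪ I)) := by
  rw [determinedBy_iff] at hA ⊢
  intro ω ω' h
  simp only [Set.mem_preimage]
  refine hA _ _ (Set.ext fun i => ?_)
  have hi : i ∈ K → i ∉ D → i ∉ I → (i ∈ ω ↔ i ∈ ω') := fun hiK hiD hiI =>
    ⟨fun hω => ((Set.ext_iff.1 h i).1 ⟨hω, hiK, fun h' => h'.elim hiD hiI⟩).1,
      fun hω => ((Set.ext_iff.1 h i).2 ⟨hω, hiK, fun h' => h'.elim hiD hiI⟩).1⟩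
  simp only [Set.mem_inter_iff, Set.mem_union, Set.mem_sdiff]
  by_cases hiD : i ∈ D
  · simp [hiD]
  · by_cases hiI : i ∈ I
    · simp [hiI]
    · constructor
      · rintro ⟨hω | hω, hiK⟩
        · exact ⟨Or.inl ⟨(hi hiK hiD hiI).1 hω.1, hiD⟩, hiK⟩
        · exact absurd hω hiI
      · rintro ⟨hω | hω, hiK⟩
        · exact ⟨Or.inl ⟨(hi hiK hiD hiI).2 hω.1, hiD⟩, hiK⟩
        · exact absurd hω hiI

/-- The modification map `ω ↦ (ω \ D) ∪ I` is measurable. -/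
theorem measurable_diff_union (D I : Set ι) : Measurable fun ω : Set ι => ω \ D ∪ I := by
  refine measurable_set_iff.2 fun i => ?_
  have h : (fun ω : Set ι => i ∈ ω \ D ∪ I) = fun ω => (i ∈ ω ∧ i ∉ D) ∨ i ∈ I := by
    funext ω
    simp only [Set.mem_union, Set.mem_sdiff]
  rw [h]
  exact ((measurable_set_mem i).and measurable_const).or measurable_const

/-- The upper section `{ω | insert e ω ∈ A}` of an event determined by `K` is determined by
`K.erase e`. -/
theorem determinedBy_insert_mem [DecidableEq ι] {A : Set (Set ι)} {K : Finset ι}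
    (hA : DeterminedBy A (↑K : Set ι)) (e : ι) :
    DeterminedBy {ω : Set ι | insert e ω ∈ A} (↑(K.erase e) : Set ι) := by
  have h := determinedBy_preimage_diff_union hA ∅ {e}
  rw [Finset.coe_erase]
  convert h using 2
  · ext ω
    simp only [Set.mem_setOf_eq, Set.mem_preimage, Set.sdiff_empty, Set.union_singleton]
  · rw [Set.empty_union]

/-- The lower section `{ω | ω \ {e} ∈ A}` of an event determined by `K` is determined by
`K.erase e`. -/
theorem determinedBy_diff_mem [DecidableEq ι] {A : Set (Set ι)} {K : Finset ι}
    (hA : DeterminedBy A (↑K : Set ι)) (e : ι) :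
    DeterminedBy {ω : Set ι | ω \ {e} ∈ A} (↑(K.erase e) : Set ι) := by
  have h := determinedBy_preimage_diff_union hA {e} ∅
  rw [Finset.coe_erase]
  convert h using 2
  · ext ω
    simp only [Set.mem_setOf_eq, Set.mem_preimage, Set.union_empty]
  · rw [Set.union_empty]

/-! ### The signed Russo formula -/

/-- **Russo's formula along a differentiable path of parameters, signed form.** Let `A` be ANY
event determined by the finite set `K`, and let the parameters `p b : ι → [0,1]` depend on a real
parameter `b` with `b ↦ p_e(b)` differentiable at `β` with derivative `p'_e` for every `e ∈ K`.
Then `b ↦ P_{p(b)}(A)` is differentiable at `β` with derivative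
`Σ_{e ∈ K} p'_e · (P_{p(β)}{ω | ω ∪ {e} ∈ A} - P_{p(β)}{ω | ω \ {e} ∈ A})`.  (For increasing
`A` the bracket is the probability that `e` is pivotal; in general it is
`P(e (+)-pivotal) - P(e (−)-pivotal)`, Grimmett 1999 eq. (2.28).)  Proof: the cylinder polynomial
`RussoPath.prodBernoulli_real_eq_sum_powerset`, the product rule, and the pairing `S ↔ S ∪ {e}`. -/
theorem hasDerivAt_prodBernoulli_real_signed [DecidableEq ι] (p : ℝ → ι → unitInterval)
    {A : Set (Set ι)} {K : Finset ι} (hK : DeterminedBy A (↑K : Set ι))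
    (β : ℝ) (p' : ι → ℝ) (hp : ∀ e ∈ K, HasDerivAt (fun b => (p b e : ℝ)) (p' e) β) :
    HasDerivAt (fun b => (prodBernoulli (p b)).real A)
      (∑ e ∈ K, p' e * ((prodBernoulli (p β)).real {ω | insert e ω ∈ A} -
        (prodBernoulli (p β)).real {ω | ω \ {e} ∈ A})) β := by
  classical
  -- the weights and their derivatives
  set w : Finset ι → ι → ℝ → ℝ := fun S i b => if i ∈ S then (p b i : ℝ) else 1 - (p b i : ℝ)
    with hw
  set dw : Finset ι → ι → ℝ := fun S i => if i ∈ S then p' i else -p' i with hdw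
  have hwd : ∀ S, ∀ i ∈ K, HasDerivAt (w S i) (dw S i) β := by
    intro S i hi
    by_cases hiS : i ∈ S
    · have h1 : w S i = fun b => (p b i : ℝ) := by funext b; simp [hw, hiS]
      have h2 : dw S i = p' i := by simp [hdw, hiS]
      rw [h1, h2]; exact hp i hi
    · have h1 : w S i = fun b => 1 - (p b i : ℝ) := by funext b; simp [hw, hiS]
      have h2 : dw S i = -p' i := by simp [hdw, hiS]
      rw [h1, h2]; exact (hp i hi).const_sub 1
  -- `P_{p(b)}(A)` is the cylinder polynomial
  have hrepr : (fun b => (prodBernoulli (p b)).real A) =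
      fun b => ∑ S ∈ K.powerset, if (↑S : Set ι) ∈ A then ∏ i ∈ K, w S i b else 0 := by
    funext b
    rw [RussoPath.prodBernoulli_real_eq_sum_powerset hK (p b)]
  rw [hrepr]
  -- differentiate term by term
  have hderiv : HasDerivAt
      (fun b => ∑ S ∈ K.powerset, if (↑S : Set ι) ∈ A then ∏ i ∈ K, w S i b else 0)
      (∑ S ∈ K.powerset, if (↑S : Set ι) ∈ A then
        ∑ e ∈ K, (∏ j ∈ K.erase e, w S j β) * dw S e else 0) β := by
    refine HasDerivAt.fun_sum fun S _ => ?_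
    split_ifs with hSA
    · have := HasDerivAt.fun_finsetProd (u := K) (x := β) (fun i hi => hwd S i hi)
      simpa [smul_eq_mul] using this
    · simpa using hasDerivAt_const β (0 : ℝ)
  -- exchange the sums and pair `S ↔ insert e S`
  convert hderiv using 1
  have hpush : (∑ S ∈ K.powerset, if (↑S : Set ι) ∈ A then
      ∑ e ∈ K, (∏ j ∈ K.erase e, w S j β) * dw S e else 0) =
      ∑ S ∈ K.powerset, ∑ e ∈ K, (if (↑S : Set ι) ∈ A then
        (∏ j ∈ K.erase e, w S j β) * dw S e else 0) := by
    refine Finset.sum_congr rfl fun S _ => ?_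
    split_ifs <;> simp
  rw [hpush, Finset.sum_comm]
  refine Finset.sum_congr rfl fun e he => ?_
  -- the `e`-th term: `p'_e · (P(A^{e←1}) - P(A^{e←0}))`
  have hup : (prodBernoulli (p β)).real {ω | insert e ω ∈ A} =
      ∑ S ∈ (K.erase e).powerset, if (↑S : Set ι) ∈ {ω : Set ι | insert e ω ∈ A} then
        ∏ i ∈ K.erase e, w S i β else 0 :=
    RussoPath.prodBernoulli_real_eq_sum_powerset (determinedBy_insert_mem hK e) (p β)
  have hdown : (prodBernoulli (p β)).real {ω | ω \ {e} ∈ A} =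
      ∑ S ∈ (K.erase e).powerset, if (↑S : Set ι) ∈ {ω : Set ι | ω \ {e} ∈ A} then
        ∏ i ∈ K.erase e, w S i β else 0 :=
    RussoPath.prodBernoulli_real_eq_sum_powerset (determinedBy_diff_mem hK e) (p β)
  rw [hup, hdown, ← Finset.sum_sub_distrib, Finset.mul_sum]
  have hpow : K.powerset = (K.erase e).powerset ∪ (K.erase e).powerset.image (insert e) := by
    rw [← Finset.powerset_insert, Finset.insert_erase he]
  have hdisj : Disjoint (K.erase e).powerset ((K.erase e).powerset.image (insert e)) := by
    rw [Finset.disjoint_left]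
    intro S hS hS'
    obtain ⟨T, -, rfl⟩ := Finset.mem_image.1 hS'
    have := Finset.mem_powerset.1 hS (Finset.mem_insert_self e T)
    simp at this
  have hinj : Set.InjOn (insert e) (↑(K.erase e).powerset : Set (Finset ι)) := by
    intro S hS T hT hST
    have heS : e ∉ S := fun h => by simpa using Finset.mem_powerset.1 hS h
    have heT : e ∉ T := fun h => by simpa using Finset.mem_powerset.1 hT h
    rw [← Finset.erase_insert heS, ← Finset.erase_insert heT, hST]
  symm
  rw [hpow, Finset.sum_union hdisj, Finset.sum_image hinj, ← Finset.sum_add_distrib]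
  refine Finset.sum_congr rfl fun S hS => ?_
  have heS : e ∉ S := fun h => by simpa using Finset.mem_powerset.1 hS h
  have heS' : e ∉ (↑S : Set ι) := by simpa using heS
  have hdS : dw S e = -p' e := by simp [hdw, heS]
  have hdiS : dw (insert e S) e = p' e := by simp [hdw]
  -- off `e` the weights of `S` and `insert e S` agree
  have hwi : ∏ j ∈ K.erase e, w (insert e S) j β = ∏ j ∈ K.erase e, w S j β := by
    refine Finset.prod_congr rfl fun j hj => ?_
    have hje : j ≠ e := Finset.ne_of_mem_erase hj
    simp [hw, Finset.mem_insert, hje]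
  have hdiff : (↑S : Set ι) \ {e} = ↑S := Set.sdiff_singleton_eq_self heS'
  rw [hdS, hdiS, hwi, Finset.coe_insert]
  simp only [Set.mem_setOf_eq, hdiff]
  by_cases hSA : (↑S : Set ι) ∈ A <;> by_cases hiA : insert e (↑S : Set ι) ∈ A <;>
    simp [hSA, hiA] <;> ring

/-! ### Cylinders over a finite set partition the space -/

/-- A cylinder `[T]_F` is determined by `F`. -/
theorem determinedBy_localCylinder (F T : Set ι) : DeterminedBy (localCylinder F T) F := by
  rw [determinedBy_iff]
  intro ω ω' h
  have h1 : ∀ i ∈ F, (i ∈ ω ↔ i ∈ ω') := fun i hi =>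
    ⟨fun hω => ((Set.ext_iff.1 h i).1 ⟨hω, hi⟩).1, fun hω => ((Set.ext_iff.1 h i).2 ⟨hω, hi⟩).1⟩
  simp only [localCylinder, Set.mem_setOf_eq]
  exact forall₂_congr fun i hi => by rw [h1 i hi]

/-- **The cylinders over a finite set `F` partition the space**: for every measurable event `E`,
`P(E) = Σ_{T ⊆ F} P(E ∩ [T]_F)`. -/
theorem measureReal_eq_sum_inter_localCylinder [DecidableEq ι] (μ : Measure (Set ι))
    [IsFiniteMeasure μ] {E : Set (Set ι)} (hE : MeasurableSet E) (F : Finset ι) :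
    μ.real E = ∑ T ∈ F.powerset, μ.real (E ∩ localCylinder (↑F : Set ι) (↑T : Set ι)) := by
  classical
  have hcover : E = ⋃ T ∈ F.powerset, E ∩ localCylinder (↑F : Set ι) (↑T : Set ι) := by
    ext ω
    simp only [Set.mem_iUnion, Set.mem_inter_iff, exists_and_left, exists_prop]
    constructor
    · intro hω
      refine ⟨hω, F.filter (· ∈ ω), Finset.mem_powerset.2 (Finset.filter_subset _ _), ?_⟩
      intro i hi
      simp [Finset.mem_coe.1 hi]
    · rintro ⟨hω, -, -, -⟩
      exact hω
  conv_lhs => rw [hcover]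
  rw [measureReal_biUnion_finset]
  · intro S hS T hT hST
    exact Disjoint.mono Set.inter_subset_right Set.inter_subset_right
      (Russo.disjoint_localCylinder (Finset.mem_powerset.1 (Finset.mem_coe.1 hS))
        (Finset.mem_powerset.1 (Finset.mem_coe.1 hT)) hST)
  · intro S _
    exact hE.inter (measurableSet_localCylinder F.finite_toSet.countable _)

/-- **Independence of a cylinder from the outside**: `P([T]_F ∩ E) = P([T]_F) · P(E)` for an
event `E` determined by the complement of the finite set `F`. -/
theorem real_localCylinder_inter (p : ι → unitInterval) (F : Finset ι) (T : Set ι)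
    {E : Set (Set ι)} (hE : DeterminedBy E (↑F : Set ι)ᶜ) (hEm : MeasurableSet E) :
    (prodBernoulli p).real (localCylinder (↑F : Set ι) T ∩ E) =
      (prodBernoulli p).real (localCylinder (↑F : Set ι) T) * (prodBernoulli p).real E :=
  prodBernoulli_real_inter_of_determinedBy p F (determinedBy_localCylinder _ _) hE
    (measurableSet_localCylinder F.finite_toSet.countable _) hEm

/-- Monotone form of the independence of a cylinder from the outside: if `E ∩ [T]_F ⊆ E'` with
`E` determined by `Fᶜ`… more usefully, **a lower bound transfers through a cylinder**:
`P([T]_F) · P(E) ≤ P(G)` whenever `[T]_F ∩ E ⊆ G`. -/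
theorem real_localCylinder_mul_le (p : ι → unitInterval) (F : Finset ι) (T : Set ι)
    {E G : Set (Set ι)} (hE : DeterminedBy E (↑F : Set ι)ᶜ) (hEm : MeasurableSet E)
    (hG : localCylinder (↑F : Set ι) T ∩ E ⊆ G) :
    (prodBernoulli p).real (localCylinder (↑F : Set ι) T) * (prodBernoulli p).real E ≤
      (prodBernoulli p).real G := by
  rw [← real_localCylinder_inter p F T hE hEm]
  exact measureReal_mono hG

/-- Upper bound through a cylinder: if `G ∩ [T]_F ⊆ E` … in the form used below,
`P(G ∩ [T]_F) ≤ P([T]_F) · P(E)` whenever `G ∩ [T]_F ⊆ [T]_F ∩ E` with `E` determined by `Fᶜ`. -/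
theorem real_inter_localCylinder_le (p : ι → unitInterval) (F : Finset ι) (T : Set ι)
    {E G : Set (Set ι)} (hE : DeterminedBy E (↑F : Set ι)ᶜ) (hEm : MeasurableSet E)
    (hG : G ∩ localCylinder (↑F : Set ι) T ⊆ E) :
    (prodBernoulli p).real (G ∩ localCylinder (↑F : Set ι) T) ≤
      (prodBernoulli p).real (localCylinder (↑F : Set ι) T) * (prodBernoulli p).real E := by
  rw [← real_localCylinder_inter p F T hE hEm]
  exact measureReal_mono fun ω hω => ⟨hω.2, hG hω⟩

/-- The probability of a cylinder: `P([T]_F) = ∏_{i ∈ F} (p_i if i ∈ T else 1 - p_i)`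
(the tree's `prodBernoulli_real_localCylinder`, restated). -/
theorem real_localCylinder_eq (p : ι → unitInterval) (F : Finset ι) (T : Set ι) [DecidablePred (· ∈ T)] :
    (prodBernoulli p).real (localCylinder (↑F : Set ι) T) =
      ∏ i ∈ F, (if i ∈ T then (p i : ℝ) else 1 - (p i : ℝ)) := by
  classical
  convert prodBernoulli_real_localCylinder p F T using 3

end Cone3

/-- **Registered sub-goal `stub_cone3_russo` of stub `stub_cone3`**: the signed Russo formula
(`Cone3.hasDerivAt_prodBernoulli_real_signed`) on the coin space `ℤ² × {0,1} × {0,1,2}` of the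
self-refinement model — the derivative of the probability of an arbitrary cylinder event along a
differentiable path of coin biases is the bias-weighted sum of its section differences. -/
theorem stub_cone3_russo : ∀ (p : ℝ → (Site 2 × Fin 2 × Fin 3) → unitInterval) (A : Set (Set (Site 2 × Fin 2 × Fin 3))) (K : Finset (Site 2 × Fin 2 × Fin 3)) (β : ℝ) (p' : (Site 2 × Fin 2 × Fin 3) → ℝ), DeterminedBy A (↑K : Set (Site 2 × Fin 2 × Fin 3)) → (∀ e ∈ K, HasDerivAt (fun b => (p b e : ℝ)) (p' e) β) → HasDerivAt (fun b => (prodBernoulli (p b)).real A) (∑ e ∈ K, p' e * ((prodBernoulli (p β)).real {ω | insert e ω ∈ A} - (prodBernoulli (p β)).real {ω | ω \ {e} ∈ A})) β :=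
  fun p _ _ β p' hK hp => Cone3.hasDerivAt_prodBernoulli_real_signed p hK β p' hp

end Summit.CriticalPhenomena.CardyFormulaZ2.Cruxes.CriticalPathRSW.FiniteSizeEnvelope

end
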